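import Summits.QuantumFields.YangMills.Theorems.BalabanUVNodesN21GappedTopPairReading13CoPHFaces

/-!
# N21 (NE7c) · dag-n21-w7's PAIR READING WITHOUT THE ∀-SIGN ROWS: `ShellWeightBound` at `crGap2₁₃VAt` on MONOTONE grids, hence under the SATISFIABLE rows
# «`0 ≤ ε` at both tops OR `ρ_K = 0`» and «`0 ≤ δ` at both old levels OR `ρ′_K = 0`» (sign-aware dials)

R134 seat `pub-ymgap-dag-n21-d` (g12, lane owner N21), strategy s2; key K3⁸ `SpineGivenEndpointR13SepCoPHV` = stmt-QuantumFields-27366, `--kind proof --supports 27366 --as helper`;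
COUNT-NEUTRAL.  Theorems only (0 `def`).  Imports dag-n21-w7 g2's `…N21GappedTopPairReading13CoPHFaces` (p636389) and through it their FILE 12–14 (`…GappedTopPair13CoPH{Defs,
Record,}`, `…GappedTopPairReading13CoPH{Defs,}`) BY NAME.

WHY (located while knitting V3, 2026-08-28): the K5 face `K3V5Defs.KeyedShellWeight cr` quantifies over EVERY `g₀ : ℕ → ℝ` (no coupling window), so a knit of the pair faces
needs their four sign rows `0 ≤ ε_{K₀+K}(histA)`, `0 ≤ ε_{K₀+K+1}(histB)`, `0 ≤ δ_{K₀+K−1}(histA)`, `0 ≤ δ_{K₀+K}(histB)` FOR ALL `g₀` — and as ∀-rows they are refutable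
(`epsOfRecord ν g k = g_k · A₀ · (log g_k⁻²)^{p₀} < 0` at `g₀ ≡ −1∕2`, `A₀ = 1`, `p₀ = 1`).  READ of dag-n21-w7's proofs: the sign rows serve ONLY to make the two letter grids
monotone (`cutGrid_succ_le_of_nonneg`, `bCutGrid_succ_le_of_nonneg`); the majorant road (`sum_range_majorantA2∕B2AtLevel_le_of_liveSel`, `argmin_badness_bounds`,
`sum_topGap2ShellAtLevel_le_majorants_of_liveSel`) is sign-free.  A grid of WIDTH ZERO is constant, hence monotone, whatever the sign.

WHAT THIS FILE PROVES (theorems only):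
§57 `cutGrid_succ_le_of_nonneg_or_width_zero` · `bCutGrid_succ_le_of_nonneg_or_width_zero` — the grids are monotone under «sign OR width zero».
§58 `gap2ShellSum_selDepths_le_of_monotone` — dag-n21-w7's `gap2ShellSum_selDepths_le` RE-KEYED on the four monotone-grid rows (proof body copied from p632256 §E3, the four
    sign-to-monotonicity lines removed; cited, not claimed).
§59 `shellWeightBound_carriersGap2₁₃_of_monotone` — their `shellWeightBound_carriersGap2₁₃` RE-KEYED likewise (proof body copied from p636389 §F2) · ★★★
    `shellWeightBound_carriersGap2₁₃'` — `T4IndicatorShell.ShellWeightBound` at the doubly-gapped carriers under the rows `hsel`, (H-ζ), `0 ≤ ρ_K, ρ′_K ≤ 1`,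
    «(`0 ≤ ε_A K ∧ 0 ≤ ε_B K`) ∨ `ρ K = 0`», «(`0 ≤ δ_A K ∧ 0 ≤ δ_B K`) ∨ `ρ′ K = 0`», `Σ_K (1∕(n₁ K+1) + 1∕(n₂ K+1)) < ∞` — SATISFIABLE for every `(θ, g₀)` (e.g. by the
    sign-aware dials `ρ̃ K := if 0 ≤ ε_A K ∧ 0 ≤ ε_B K then ρ K else 0`, which agree with `ρ` wherever the signs hold) · `shellWeightBound_crGap2₁₃VAt'` (reading level, canonical
    `Wsh`) · `keyedShellWeight_shape_crGap2₁₃V_of_rows'` (the K3 stub-2 conjunct's ∀-shape modulo the satisfiable rows).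

HONEST FRAMING: bookkeeping; two proof bodies of dag-n21-w7 re-keyed (cited); no estimate of Bałaban's; NE7c at print's FIXED thresholds NOT PRINTED ∕ NOT proved; N21 NOT
discharged at the v6 pin; K3⁷∕K3⁸ NOT claimed; counts UNMOVED (typed 28∕28 · discharged 5∕27); one finite 𝕋⁴ — nothing about ℝ⁴ ∕ OS ∕ mass gap ∕ Clay.
[III] = [Balaban1988Convergent], [LF-I] = [Balaban1989LargeFieldI].
-/

open scoped BigOperators
open Finset MeasureTheory

noncomputable section

namespace Summit.QuantumFields.YangMills.Theorems.N21ShellSplitOfRecord13CoPH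

open Literature.MathematicalPhysics.QuantumFieldTheory.Balaban1983to89
open Literature.MathematicalPhysics.QuantumFieldTheory.Balaban1983to89.T4Continuum
open Literature.MathematicalPhysics.QuantumFieldTheory.Balaban1983to89.Node00
open YMDAG.UVSplit (SpineReading₁₃CoPH keyA₁₃ keyB₁₃ runA₁₃ runB₁₃ histA₁₃ histB₁₃ histA₁₃_zero histB₁₃_zero classSet₁₃ badClass₁₃)
open T4IndicatorShell (ShellWeightBound)
open Summit.QuantumFields.YangMills.BalabanUVNodes.SpineCanonicalWeights (shellWeightBound_wshInf)
open Summit.QuantumFields.YangMills.Theorems.N21StepWeightsPositivity (zetaOfRecord_nonneg)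
open Summit.QuantumFields.YangMills.BalabanUVNodes.N19MGFFormAtRecordMass (sum_classWeightOfDatum₉_datumOfRecord₁₃CoPH_eq_schemeZ_of_ppSelLive)
open Summit.QuantumFields.YangMills.BalabanUVNodes.N19MGFFormAtRecord (wOfRecord₉_nonneg)
open Summit.QuantumFields.YangMills.Theorems.N21GappedTopPair13CoPH

/-! ## §57 Monotone grids under «sign OR width zero» -/

section Grids

/-- The (3.2) grid `θ_i = ε(1−ρ)^i` is non-increasing in `i` when `0 ≤ ε` OR the width `ρ` is zero (then it is constant), `0 ≤ ρ ≤ 1`. [bookkeeping] -/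
theorem cutGrid_succ_le_of_nonneg_or_width_zero {ν : Stage7Numerics} {g : ℕ → ℝ} {j : ℕ} {ρ : ℝ} (h : 0 ≤ epsOfRecord ν g j ∨ ρ = 0) (hρ0 : 0 ≤ ρ) (hρ1 : ρ ≤ 1)
    (i : ℕ) : cutGrid ν g j ρ (i + 1) ≤ cutGrid ν g j ρ i := by
  rcases h with h | rfl
  · exact cutGrid_succ_le_of_nonneg ν j h hρ0 hρ1 i
  · simp [cutGrid]

/-- The (3.3) grid `2δ(1−ρ′)^j` is non-increasing in `j` when `0 ≤ δ` OR the width `ρ′` is zero, `0 ≤ ρ′ ≤ 1`. [bookkeeping] -/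
theorem bCutGrid_succ_le_of_nonneg_or_width_zero {ν : Stage7Numerics} {A₁ : ℝ} {g : ℕ → ℝ} {k : ℕ} {ρ' : ℝ} (h : 0 ≤ deltaOfRecord ν g k A₁ ∨ ρ' = 0) (hρ0 : 0 ≤ ρ')
    (hρ1 : ρ' ≤ 1) (j : ℕ) : bCutGrid ν A₁ g k ρ' (j + 1) ≤ bCutGrid ν A₁ g k ρ' j := by
  rcases h with h | rfl
  · exact bCutGrid_succ_le_of_nonneg ν A₁ g k h hρ0 hρ1 j
  · simp [bCutGrid]

end Grids

/-! ## §58 The bound at the selected depth pair on MONOTONE grids (dag-n21-w7's `gap2ShellSum_selDepths_le`, re-keyed) -/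

section AtReading2M

variable {F : T4Family} {N : ℕ} [NeZero N]

/-- ★★ **BOTH RUNS' TWO-COLLAR SHELL MASSES AT THE SELECTED DEPTH PAIR ARE `≤ 4(2L^m)⁴(1∕(n₁+1) + 1∕(n₂+1)) ×` THE RUNS' PARTITION FUNCTIONS — ON MONOTONE GRIDS** (dag-n21-w7's
`gap2ShellSum_selDepths_le` p632256 §E3 with its four sign rows replaced by the four grid-monotonicity rows they served; proof body theirs).  Rows: `hsel`, (H-ζ), the four
monotone-grid rows. [bookkeeping] -/
theorem gap2ShellSum_selDepths_le_of_monotone (K₀ : ℕ) (θ : Stage13HParams F N) (hP : θ.Provisos₁₃CoPH F N) (g₀ : ℕ → ℝ) (os : List (ULoop F))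
    (E : B12.RunParams → ℝ) (hsel : θ.ppSel = ppSelLiveOfRecord F N θ.ν θ.τ9 E (wOfRecord₉ F N θ.toStage9Params)) (hζm : ZetaMeasurable F N θ.ζ)
    (ρ ρ' : ℕ → ℝ) (n₁ n₂ K : ℕ) (t : ℝ)
    (hθA : ∀ i, cutGrid θ.ν (histA₁₃ θ K₀ g₀ K) (K₀ + K) (ρ K) (i + 1) ≤ cutGrid θ.ν (histA₁₃ θ K₀ g₀ K) (K₀ + K) (ρ K) i)
    (hθB : ∀ i, cutGrid θ.ν (histB₁₃ θ K₀ g₀ K) (K₀ + K + 1) (ρ K) (i + 1) ≤ cutGrid θ.ν (histB₁₃ θ K₀ g₀ K) (K₀ + K + 1) (ρ K) i)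
    (hδ'A : ∀ j, bCutGrid θ.ν θ.A₁ (histA₁₃ θ K₀ g₀ K) (K₀ + K - 1) (ρ' K) (j + 1) ≤ bCutGrid θ.ν θ.A₁ (histA₁₃ θ K₀ g₀ K) (K₀ + K - 1) (ρ' K) j)
    (hδ'B : ∀ j, bCutGrid θ.ν θ.A₁ (histB₁₃ θ K₀ g₀ K) (K₀ + K) (ρ' K) (j + 1) ≤ bCutGrid θ.ν θ.A₁ (histB₁₃ θ K₀ g₀ K) (K₀ + K) (ρ' K) j) :
    gap2ShellSumA₁₃ θ hP K₀ g₀ os ρ ρ' K (selDepthA2₁₃ θ hP K₀ g₀ os ρ n₁ K t) (selDepthB2₁₃ θ hP K₀ g₀ os ρ' n₂ K t) t ≤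
        4 * (2 * (F.L : ℝ) ^ F.m) ^ 4 * (1 / (n₁ + 1 : ℕ) + 1 / (n₂ + 1 : ℕ)) * T4GenFunBounds.schemeZ ((datumOfRecord₁₃CoPH F N θ hP).scheme g₀) os (K₀ + K) t ∧
      gap2ShellSumB₁₃ θ hP K₀ g₀ os ρ ρ' K (selDepthA2₁₃ θ hP K₀ g₀ os ρ n₁ K t) (selDepthB2₁₃ θ hP K₀ g₀ os ρ' n₂ K t) t ≤
        4 * (2 * (F.L : ℝ) ^ F.m) ^ 4 * (1 / (n₁ + 1 : ℕ) + 1 / (n₂ + 1 : ℕ)) *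
          T4GenFunBounds.schemeZ ((datumOfRecord₁₃CoPH F N θ hP).scheme g₀) os (K₀ + K + 1) t := by
  -- adapted from dag-n21-w7's `gap2ShellSum_selDepths_le` (p632256 §E3): the same proof with the monotone grids taken as rows
  have hζ0 : ∀ p g k s Pl Ql RS U V', 0 ≤ θ.ζ p g k s Pl Ql RS U V' :=
    fun p g k s Pl Ql RS U V' => zetaOfRecord_nonneg F N θ.ν θ.τ9.M hP.zetaUnity hP.zetaAbs p g k s Pl Ql RS U V'
  have hU : LocalBgMeasurable F N θ.ν := localBgMeasurable F N θ.ν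
  set X : ℝ := (2 * (F.L : ℝ) ^ F.m) ^ 4 with hX
  set ZA : ℝ := T4GenFunBounds.schemeZ ((datumOfRecord₁₃CoPH F N θ hP).scheme g₀) os (K₀ + K) t with hZA
  set ZB : ℝ := T4GenFunBounds.schemeZ ((datumOfRecord₁₃CoPH F N θ hP).scheme g₀) os (K₀ + K + 1) t with hZB
  set i := selDepthA2₁₃ θ hP K₀ g₀ os ρ n₁ K t with hi
  set j := selDepthB2₁₃ θ hP K₀ g₀ os ρ' n₂ K t with hj
  have hZ : ∀ (p : B12.RunParams) (g : ℕ → ℝ), g 0 = g₀ p.K → 0 ≤ T4GenFunBounds.schemeZ ((datumOfRecord₁₃CoPH F N θ hP).scheme g₀) os p.K t := by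
    intro p g hg
    rw [← sum_classWeightOfDatum₉_datumOfRecord₁₃CoPH_eq_schemeZ_of_ppSelLive θ hP E hsel hU hζm hζ0 g₀ os hg t 0 (Nat.zero_le _)]
    exact Finset.sum_nonneg fun s _ => classWeightOfDatum₉_nonneg' F N θ.toStage9Params (datumOfRecord₁₃CoPH F N θ hP) g₀ os p g 0
      (wOfRecord₉_nonneg θ.toStage9Params hζ0 p g) t s
  have hZA0 : 0 ≤ ZA := hZ (runA₁₃ F K₀ g₀ K) _ (histA₁₃_zero θ K₀ g₀ K)
  have hZB0 : 0 ≤ ZB := hZ (runB₁₃ F K₀ g₀ K) _ (histB₁₃_zero θ K₀ g₀ K)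
  have hfaA0 : ∀ i, 0 ≤ majA2SumA₁₃ θ hP K₀ g₀ os ρ K i t := fun i =>
    majorantA2AtLevel_nonneg F N θ.toStage9Params (datumOfRecord₁₃CoPH F N θ hP) g₀ os _ _ hζ0 ((hθA (i + 1)).trans (hθA i)) t _
  have hfaB0 : ∀ i, 0 ≤ majA2SumB₁₃ θ hP K₀ g₀ os ρ K i t := fun i =>
    majorantA2AtLevel_nonneg F N θ.toStage9Params (datumOfRecord₁₃CoPH F N θ hP) g₀ os _ _ hζ0 ((hθB (i + 1)).trans (hθB i)) t _
  have hfbA0 : ∀ j, 0 ≤ majB2SumA₁₃ θ hP K₀ g₀ os ρ' K j t := fun j =>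
    majorantB2AtLevel_nonneg F N θ.toStage9Params (datumOfRecord₁₃CoPH F N θ hP) g₀ os _ _ hζ0 ((hδ'A (j + 1)).trans (hδ'A j)) t _
  have hfbB0 : ∀ j, 0 ≤ majB2SumB₁₃ θ hP K₀ g₀ os ρ' K j t := fun j =>
    majorantB2AtLevel_nonneg F N θ.toStage9Params (datumOfRecord₁₃CoPH F N θ hP) g₀ os _ _ hζ0 ((hδ'B (j + 1)).trans (hδ'B j)) t _
  have hsaA : ∑ i ∈ Finset.range (n₁ + 1), majA2SumA₁₃ θ hP K₀ g₀ os ρ K i t ≤ 2 * X * ZA := by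
    have h := sum_range_majorantA2AtLevel_le_of_liveSel θ hP E hsel hζm g₀ os (p := runA₁₃ F K₀ g₀ K) (histA₁₃_zero θ K₀ g₀ K) (ρ K) (n₁ + 1) t (K₀ + K) rfl
    rw [YMDAG.UVSplit.runA₁₃_K] at h; exact h
  have hsaB : ∑ i ∈ Finset.range (n₁ + 1), majA2SumB₁₃ θ hP K₀ g₀ os ρ K i t ≤ 2 * X * ZB := by
    have h := sum_range_majorantA2AtLevel_le_of_liveSel θ hP E hsel hζm g₀ os (p := runB₁₃ F K₀ g₀ K) (histB₁₃_zero θ K₀ g₀ K) (ρ K) (n₁ + 1) t (K₀ + K + 1) rfl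
    rw [YMDAG.UVSplit.runB₁₃_K] at h; exact h
  have hsbA : ∑ j ∈ Finset.range (n₂ + 1), majB2SumA₁₃ θ hP K₀ g₀ os ρ' K j t ≤ 2 * X * ZA := by
    have h := sum_range_majorantB2AtLevel_le_of_liveSel θ hP E hsel hζm g₀ os (p := runA₁₃ F K₀ g₀ K) (histA₁₃_zero θ K₀ g₀ K)
      (bCutGrid θ.ν θ.A₁ (histA₁₃ θ K₀ g₀ K) (K₀ + K - 1) (ρ' K)) (n₂ + 1) t (K₀ + K) rfl
    rw [YMDAG.UVSplit.runA₁₃_K] at h; exact h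
  have hsbB : ∑ j ∈ Finset.range (n₂ + 1), majB2SumB₁₃ θ hP K₀ g₀ os ρ' K j t ≤ 2 * X * ZB := by
    have h := sum_range_majorantB2AtLevel_le_of_liveSel θ hP E hsel hζm g₀ os (p := runB₁₃ F K₀ g₀ K) (histB₁₃_zero θ K₀ g₀ K)
      (bCutGrid θ.ν θ.A₁ (histB₁₃ θ K₀ g₀ K) (K₀ + K) (ρ' K)) (n₂ + 1) t (K₀ + K + 1) rfl
    rw [YMDAG.UVSplit.runB₁₃_K] at h; exact h
  have hspecA := selDepthA2₁₃_spec θ hP K₀ g₀ os ρ n₁ K t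
  have hspecB := selDepthB2₁₃_spec θ hP K₀ g₀ os ρ' n₂ K t
  obtain ⟨haA, haB⟩ := argmin_badness_bounds (f := fun i => majA2SumA₁₃ θ hP K₀ g₀ os ρ K i t) (g := fun i => majA2SumB₁₃ θ hP K₀ g₀ os ρ K i t)
    hfaA0 hfaB0 hZA0 hZB0 (by positivity) hsaA hsaB hspecA.1 hspecA.2
  obtain ⟨hbA, hbB⟩ := argmin_badness_bounds (f := fun j => majB2SumA₁₃ θ hP K₀ g₀ os ρ' K j t) (g := fun j => majB2SumB₁₃ θ hP K₀ g₀ os ρ' K j t)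
    hfbA0 hfbB0 hZA0 hZB0 (by positivity) hsbA hsbB hspecB.1 hspecB.2
  have hMA := sum_topGap2ShellAtLevel_le_majorants_of_liveSel θ hP E hsel hζm g₀ os (p := runA₁₃ F K₀ g₀ K) (histA₁₃_zero θ K₀ g₀ K)
    (hθA (i + 1)) (hθA i) (hδ'A (j + 1)) (hδ'A j) t (K₀ + K) rfl
  have hMB := sum_topGap2ShellAtLevel_le_majorants_of_liveSel θ hP E hsel hζm g₀ os (p := runB₁₃ F K₀ g₀ K) (histB₁₃_zero θ K₀ g₀ K)
    (hθB (i + 1)) (hθB i) (hδ'B (j + 1)) (hδ'B j) t (K₀ + K + 1) rfl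
  have hnum : ∀ Z : ℝ, 2 * (2 * X) / ((n₁ + 1 : ℕ) : ℝ) * Z + 2 * (2 * X) / ((n₂ + 1 : ℕ) : ℝ) * Z = 4 * X * (1 / (n₁ + 1 : ℕ) + 1 / (n₂ + 1 : ℕ)) * Z :=
    fun Z => by ring
  refine ⟨?_, ?_⟩
  · calc gap2ShellSumA₁₃ θ hP K₀ g₀ os ρ ρ' K i j t ≤ majA2SumA₁₃ θ hP K₀ g₀ os ρ K i t + majB2SumA₁₃ θ hP K₀ g₀ os ρ' K j t := hMA
      _ ≤ 2 * (2 * X) / ((n₁ + 1 : ℕ) : ℝ) * ZA + 2 * (2 * X) / ((n₂ + 1 : ℕ) : ℝ) * ZA := by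
          have h1 : majA2SumA₁₃ θ hP K₀ g₀ os ρ K i t ≤ 2 * (2 * X) / ((n₁ + 1 : ℕ) : ℝ) * ZA := by simpa using haA
          have h2 : majB2SumA₁₃ θ hP K₀ g₀ os ρ' K j t ≤ 2 * (2 * X) / ((n₂ + 1 : ℕ) : ℝ) * ZA := by simpa using hbA
          linarith
      _ = 4 * X * (1 / (n₁ + 1 : ℕ) + 1 / (n₂ + 1 : ℕ)) * ZA := hnum ZA
  · calc gap2ShellSumB₁₃ θ hP K₀ g₀ os ρ ρ' K i j t ≤ majA2SumB₁₃ θ hP K₀ g₀ os ρ K i t + majB2SumB₁₃ θ hP K₀ g₀ os ρ' K j t := hMB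
      _ ≤ 2 * (2 * X) / ((n₁ + 1 : ℕ) : ℝ) * ZB + 2 * (2 * X) / ((n₂ + 1 : ℕ) : ℝ) * ZB := by
          have h1 : majA2SumB₁₃ θ hP K₀ g₀ os ρ K i t ≤ 2 * (2 * X) / ((n₁ + 1 : ℕ) : ℝ) * ZB := by simpa using haB
          have h2 : majB2SumB₁₃ θ hP K₀ g₀ os ρ' K j t ≤ 2 * (2 * X) / ((n₂ + 1 : ℕ) : ℝ) * ZB := by simpa using hbB
          linarith
      _ = 4 * X * (1 / (n₁ + 1 : ℕ) + 1 / (n₂ + 1 : ℕ)) * ZB := hnum ZB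

/-! ## §59 `ShellWeightBound` at the doubly-gapped carriers on monotone grids; under the satisfiable «sign OR width zero» rows; at the reading -/

/-- ★★ **E2 AT THE DOUBLY-GAPPED READING ON MONOTONE GRIDS** (dag-n21-w7's `shellWeightBound_carriersGap2₁₃` p636389 §F2 with its four sign rows replaced by the four
grid-monotonicity rows; proof body theirs).  Rows: `hsel`, (H-ζ), the monotone grids, `Σ_K (1∕(n₁ K+1) + 1∕(n₂ K+1)) < ∞`. [bookkeeping] -/
theorem shellWeightBound_carriersGap2₁₃_of_monotone (K₀ : ℕ) (θ : Stage13HParams F N) (hP : θ.Provisos₁₃CoPH F N) (g₀ : ℕ → ℝ) (os : List (ULoop F))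
    (E : B12.RunParams → ℝ) (hsel : θ.ppSel = ppSelLiveOfRecord F N θ.ν θ.τ9 E (wOfRecord₉ F N θ.toStage9Params)) (hζm : ZetaMeasurable F N θ.ζ)
    {ρ ρ' : ℕ → ℝ} {n₁ n₂ : ℕ → ℕ}
    (hθA : ∀ K i, cutGrid θ.ν (histA₁₃ θ K₀ g₀ K) (K₀ + K) (ρ K) (i + 1) ≤ cutGrid θ.ν (histA₁₃ θ K₀ g₀ K) (K₀ + K) (ρ K) i)
    (hθB : ∀ K i, cutGrid θ.ν (histB₁₃ θ K₀ g₀ K) (K₀ + K + 1) (ρ K) (i + 1) ≤ cutGrid θ.ν (histB₁₃ θ K₀ g₀ K) (K₀ + K + 1) (ρ K) i)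
    (hδ'A : ∀ K j, bCutGrid θ.ν θ.A₁ (histA₁₃ θ K₀ g₀ K) (K₀ + K - 1) (ρ' K) (j + 1) ≤ bCutGrid θ.ν θ.A₁ (histA₁₃ θ K₀ g₀ K) (K₀ + K - 1) (ρ' K) j)
    (hδ'B : ∀ K j, bCutGrid θ.ν θ.A₁ (histB₁₃ θ K₀ g₀ K) (K₀ + K) (ρ' K) (j + 1) ≤ bCutGrid θ.ν θ.A₁ (histB₁₃ θ K₀ g₀ K) (K₀ + K) (ρ' K) j)
    (hn : Summable (fun K => 1 / ((n₁ K : ℝ) + 1) + 1 / ((n₂ K : ℝ) + 1))) :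
    ShellWeightBound 1 (classSet₁₃ θ K₀ g₀) (gapWeight2A₁₃ θ hP K₀ g₀ os ρ ρ' n₁ n₂) (gapWeight2B₁₃ θ hP K₀ g₀ os ρ ρ' n₁ n₂) (gapShell2A₁₃ θ hP K₀ g₀ os ρ ρ' n₁ n₂)
      (gapShell2B₁₃ θ hP K₀ g₀ os ρ ρ' n₁ n₂) (fun K => 4 * (2 * (F.L : ℝ) ^ F.m) ^ 4 * (1 / ((n₁ K : ℝ) + 1) + 1 / ((n₂ K : ℝ) + 1))) := by
  -- adapted from dag-n21-w7's `shellWeightBound_carriersGap2₁₃` (p636389 §F2): the same proof with the monotone grids taken as rows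
  have hζ0 : ∀ p g k s Pl Ql RS U V', 0 ≤ θ.ζ p g k s Pl Ql RS U V' :=
    fun p g k s Pl Ql RS U V' => zetaOfRecord_nonneg F N θ.ν θ.τ9.M hP.zetaUnity hP.zetaAbs p g k s Pl Ql RS U V'
  have hU : LocalBgMeasurable F N θ.ν := localBgMeasurable F N θ.ν
  have hD : (datumOfRecord₁₃CoPH F N θ hP).AvgMeasurable := (isPrintedAveraged_datumOfRecord₁₃CoPH F N θ hP).avgMeasurable
  have hνbar : 0 ≤ 4 * (2 * (F.L : ℝ) ^ F.m) ^ 4 := by positivity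
  have hconst : ∀ K, 4 * (2 * (F.L : ℝ) ^ F.m) ^ 4 * (1 / (n₁ K + 1 : ℕ) + 1 / (n₂ K + 1 : ℕ)) =
      4 * (2 * (F.L : ℝ) ^ F.m) ^ 4 * (1 / ((n₁ K : ℝ) + 1) + 1 / ((n₂ K : ℝ) + 1)) := fun K => by push_cast; ring
  have hintA : ∀ K k, k < (runA₁₃ F K₀ g₀ K).K → ∀ s : SeqOfRecord F θ.ν θ.τ9.M (histA₁₃ θ K₀ g₀ K) (runA₁₃ F K₀ g₀ K).K k, ∀ t : ℝ,
      Integrable (fun U => chiSeqOfRecord F N θ.ν θ.τ9.M (histA₁₃ θ K₀ g₀ K) (runA₁₃ F K₀ g₀ K).K k s U *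
        dressedSlotsOfDatum₉ F N θ.toStage9Params (datumOfRecord₁₃CoPH F N θ hP) g₀ os t (runA₁₃ F K₀ g₀ K) (histA₁₃ θ K₀ g₀ K) k s U)
        (fieldMeasure (F.P (runA₁₃ F K₀ g₀ K).K) k (SU N)) :=
    fun K k _ s t => integrable_chi_mul_dressedSlots_of_ppSelLive θ.toStage9Params E hsel hU hζm hζ0 hP.zetaAbs _ hD g₀ os (histA₁₃_zero θ K₀ g₀ K) t k s
  have hintB : ∀ K k, k < (runB₁₃ F K₀ g₀ K).K → ∀ s : SeqOfRecord F θ.ν θ.τ9.M (histB₁₃ θ K₀ g₀ K) (runB₁₃ F K₀ g₀ K).K k, ∀ t : ℝ,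
      Integrable (fun U => chiSeqOfRecord F N θ.ν θ.τ9.M (histB₁₃ θ K₀ g₀ K) (runB₁₃ F K₀ g₀ K).K k s U *
        dressedSlotsOfDatum₉ F N θ.toStage9Params (datumOfRecord₁₃CoPH F N θ hP) g₀ os t (runB₁₃ F K₀ g₀ K) (histB₁₃ θ K₀ g₀ K) k s U)
        (fieldMeasure (F.P (runB₁₃ F K₀ g₀ K).K) k (SU N)) :=
    fun K k _ s t => integrable_chi_mul_dressedSlots_of_ppSelLive θ.toStage9Params E hsel hU hζm hζ0 hP.zetaAbs _ hD g₀ os (histB₁₃_zero θ K₀ g₀ K) t k s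
  letI : ∀ Kc, DecidableEq (SiteSeqKey F Kc) := fun _ => Classical.decEq _
  refine
    { nonneg := fun K => mul_nonneg hνbar (by positivity)
      summable := hn.mul_left _
      sh_nonneg_left := fun K t _ x _ => Finset.sum_nonneg fun s _ =>
        topGap2ShellAtLevel_nonneg F N θ.toStage9Params (datumOfRecord₁₃CoPH F N θ hP) g₀ os (runA₁₃ F K₀ g₀ K) (histA₁₃ θ K₀ g₀ K) hζ0 hζm hP.zetaAbs
          (hθA K _) (hθA K _) (hδ'A K _) (hδ'A K _) t (fun k hk s => hintA K k hk s t) (K₀ + K) rfl s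
      sh_le_left := fun K t _ x _ => Finset.sum_le_sum fun s _ =>
        topGap2ShellAtLevel_le F N θ.toStage9Params (datumOfRecord₁₃CoPH F N θ hP) g₀ os (runA₁₃ F K₀ g₀ K) (histA₁₃ θ K₀ g₀ K) hζ0 _ _ _ _ _ _ t (K₀ + K) s
      sh_nonneg_right := fun K t _ x _ => Finset.sum_nonneg fun s' _ =>
        topGap2ShellAtLevel_nonneg F N θ.toStage9Params (datumOfRecord₁₃CoPH F N θ hP) g₀ os (runB₁₃ F K₀ g₀ K) (histB₁₃ θ K₀ g₀ K) hζ0 hζm hP.zetaAbs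
          (hθB K _) (hθB K _) (hδ'B K _) (hδ'B K _) t (fun k hk s => hintB K k hk s t) (K₀ + K + 1) rfl s'
      sh_le_right := fun K t _ x _ => Finset.sum_le_sum fun s' _ =>
        topGap2ShellAtLevel_le F N θ.toStage9Params (datumOfRecord₁₃CoPH F N θ hP) g₀ os (runB₁₃ F K₀ g₀ K) (histB₁₃ θ K₀ g₀ K) hζ0 _ _ _ _ _ _ t (K₀ + K + 1) s'
      left := fun K t _ => ?_
      right := fun K t _ => ?_ }
  · rw [sum_classSet₁₃_gapShell2A₁₃, sum_classSet₁₃_gapWeight2A₁₃_eq_schemeZ K₀ θ hP g₀ os E hsel hζm, ← hconst K]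
    exact (gap2ShellSum_selDepths_le_of_monotone K₀ θ hP g₀ os E hsel hζm ρ ρ' (n₁ K) (n₂ K) K t (hθA K) (hθB K) (hδ'A K) (hδ'B K)).1
  · rw [sum_classSet₁₃_gapShell2B₁₃, sum_classSet₁₃_gapWeight2B₁₃_eq_schemeZ K₀ θ hP g₀ os E hsel hζm, ← hconst K]
    exact (gap2ShellSum_selDepths_le_of_monotone K₀ θ hP g₀ os E hsel hζm ρ ρ' (n₁ K) (n₂ K) K t (hθA K) (hθB K) (hδ'A K) (hδ'B K)).2

/-- ★★★ **E2 AT THE DOUBLY-GAPPED READING UNDER THE SATISFIABLE ROWS** «`0 ≤ ε` at both tops OR `ρ_K = 0`», «`0 ≤ δ` at both old levels OR `ρ′_K = 0`» (+ `hsel`, (H-ζ),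
`0 ≤ ρ_K, ρ′_K ≤ 1`, `Σ_K (1∕(n₁ K+1) + 1∕(n₂ K+1)) < ∞`).  Sign-aware dials (`ρ̃ K := if 0 ≤ ε_A K ∧ 0 ≤ ε_B K then ρ K else 0`, same for `ρ′`) satisfy the two rows for
EVERY `(θ, g₀)` and agree with `(ρ, ρ′)` wherever the signs hold. [bookkeeping] -/
theorem shellWeightBound_carriersGap2₁₃' (K₀ : ℕ) (θ : Stage13HParams F N) (hP : θ.Provisos₁₃CoPH F N) (g₀ : ℕ → ℝ) (os : List (ULoop F)) (E : B12.RunParams → ℝ)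
    (hsel : θ.ppSel = ppSelLiveOfRecord F N θ.ν θ.τ9 E (wOfRecord₉ F N θ.toStage9Params)) (hζm : ZetaMeasurable F N θ.ζ)
    {ρ ρ' : ℕ → ℝ} {n₁ n₂ : ℕ → ℕ} (hρ0 : ∀ K, 0 ≤ ρ K) (hρ1 : ∀ K, ρ K ≤ 1) (hρ'0 : ∀ K, 0 ≤ ρ' K) (hρ'1 : ∀ K, ρ' K ≤ 1)
    (hε : ∀ K, (0 ≤ epsOfRecord θ.ν (histA₁₃ θ K₀ g₀ K) (K₀ + K) ∧ 0 ≤ epsOfRecord θ.ν (histB₁₃ θ K₀ g₀ K) (K₀ + K + 1)) ∨ ρ K = 0)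
    (hδ : ∀ K, (0 ≤ deltaOfRecord θ.ν (histA₁₃ θ K₀ g₀ K) (K₀ + K - 1) θ.A₁ ∧ 0 ≤ deltaOfRecord θ.ν (histB₁₃ θ K₀ g₀ K) (K₀ + K) θ.A₁) ∨ ρ' K = 0)
    (hn : Summable (fun K => 1 / ((n₁ K : ℝ) + 1) + 1 / ((n₂ K : ℝ) + 1))) :
    ShellWeightBound 1 (classSet₁₃ θ K₀ g₀) (gapWeight2A₁₃ θ hP K₀ g₀ os ρ ρ' n₁ n₂) (gapWeight2B₁₃ θ hP K₀ g₀ os ρ ρ' n₁ n₂) (gapShell2A₁₃ θ hP K₀ g₀ os ρ ρ' n₁ n₂)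
      (gapShell2B₁₃ θ hP K₀ g₀ os ρ ρ' n₁ n₂) (fun K => 4 * (2 * (F.L : ℝ) ^ F.m) ^ 4 * (1 / ((n₁ K : ℝ) + 1) + 1 / ((n₂ K : ℝ) + 1))) :=
  shellWeightBound_carriersGap2₁₃_of_monotone K₀ θ hP g₀ os E hsel hζm
    (fun K => cutGrid_succ_le_of_nonneg_or_width_zero ((hε K).imp_left And.left) (hρ0 K) (hρ1 K))
    (fun K => cutGrid_succ_le_of_nonneg_or_width_zero ((hε K).imp_left And.right) (hρ0 K) (hρ1 K))
    (fun K => bCutGrid_succ_le_of_nonneg_or_width_zero ((hδ K).imp_left And.left) (hρ'0 K) (hρ'1 K))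
    (fun K => bCutGrid_succ_le_of_nonneg_or_width_zero ((hδ K).imp_left And.right) (hρ'0 K) (hρ'1 K)) hn

/-- ★★★ **`KeyedShellWeight` AT THE DOUBLY-GAPPED READING UNDER THE SATISFIABLE ROWS**: `ShellWeightBound` AT `crGap2₁₃VAt N K₀ jcut ρ ρ′ n₁ n₂` — its `l₀, T, A, B, shA,
shB` and CANONICAL `Wsh` — read at the tuple (n20-d's `shellWeightBound_wshInf`); `jcut` not read. [bookkeeping] -/
theorem shellWeightBound_crGap2₁₃VAt' (K₀ : ℕ) (jcut : ℕ → ℕ) (ρ ρ' : WidthLetter₁₃CoPH N) (n₁ n₂ : DepthLetter₁₃CoPH N) (θ : Stage13HParams F N)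
    (hP : θ.Provisos₁₃CoPH F N) (g₀ : ℕ → ℝ) (os : List (ULoop F)) (E : B12.RunParams → ℝ)
    (hsel : θ.ppSel = ppSelLiveOfRecord F N θ.ν θ.τ9 E (wOfRecord₉ F N θ.toStage9Params)) (hζm : ZetaMeasurable F N θ.ζ)
    (hρ0 : ∀ K, 0 ≤ ρ F θ hP g₀ os K) (hρ1 : ∀ K, ρ F θ hP g₀ os K ≤ 1) (hρ'0 : ∀ K, 0 ≤ ρ' F θ hP g₀ os K) (hρ'1 : ∀ K, ρ' F θ hP g₀ os K ≤ 1)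
    (hε : ∀ K, (0 ≤ epsOfRecord θ.ν (histA₁₃ θ K₀ g₀ K) (K₀ + K) ∧ 0 ≤ epsOfRecord θ.ν (histB₁₃ θ K₀ g₀ K) (K₀ + K + 1)) ∨ ρ F θ hP g₀ os K = 0)
    (hδ : ∀ K, (0 ≤ deltaOfRecord θ.ν (histA₁₃ θ K₀ g₀ K) (K₀ + K - 1) θ.A₁ ∧ 0 ≤ deltaOfRecord θ.ν (histB₁₃ θ K₀ g₀ K) (K₀ + K) θ.A₁) ∨ ρ' F θ hP g₀ os K = 0)
    (hn : Summable (fun K => 1 / ((n₁ F θ hP g₀ os K : ℝ) + 1) + 1 / ((n₂ F θ hP g₀ os K : ℝ) + 1))) :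
    ShellWeightBound (crGap2₁₃VAt N K₀ jcut ρ ρ' n₁ n₂ F θ hP g₀ os).l₀ (crGap2₁₃VAt N K₀ jcut ρ ρ' n₁ n₂ F θ hP g₀ os).T
      (crGap2₁₃VAt N K₀ jcut ρ ρ' n₁ n₂ F θ hP g₀ os).A (crGap2₁₃VAt N K₀ jcut ρ ρ' n₁ n₂ F θ hP g₀ os).B (crGap2₁₃VAt N K₀ jcut ρ ρ' n₁ n₂ F θ hP g₀ os).shA
      (crGap2₁₃VAt N K₀ jcut ρ ρ' n₁ n₂ F θ hP g₀ os).shB (crGap2₁₃VAt N K₀ jcut ρ ρ' n₁ n₂ F θ hP g₀ os).Wsh :=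
  shellWeightBound_wshInf (shellWeightBound_carriersGap2₁₃' K₀ θ hP g₀ os E hsel hζm hρ0 hρ1 hρ'0 hρ'1 hε hδ hn)

/-- ★★ **THE K3 STUB-2 CONJUNCT `KeyedShellWeight` AT `crGap2₁₃V`, ∀-SHAPE, MODULO THE SATISFIABLE ROWS** (live-selector pin, (H-ζ), the dial rows, «sign OR width zero» twice,
`Σ_K (1∕(n₁ K+1) + 1∕(n₂ K+1)) < ∞`) — `crGap2₁₃V = crGap2₁₃VAt N 0` (`rfl`). [bookkeeping] -/
theorem keyedShellWeight_shape_crGap2₁₃V_of_rows' (jcut : ℕ → ℕ) (ρ ρ' : WidthLetter₁₃CoPH N) (n₁ n₂ : DepthLetter₁₃CoPH N)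
    (E : (F : T4Family) → Stage13HParams F N → (B12.RunParams → ℝ)) :
    ∀ (F : T4Family) (θ : Stage13HParams F N) (hP : θ.Provisos₁₃CoPH F N),
      θ.ppSel = ppSelLiveOfRecord F N θ.ν θ.τ9 (E F θ) (wOfRecord₉ F N θ.toStage9Params) → ZetaMeasurable F N θ.ζ →
      ∀ (g₀ : ℕ → ℝ) (os : List (ULoop F)),
        (∀ K, 0 ≤ ρ F θ hP g₀ os K) → (∀ K, ρ F θ hP g₀ os K ≤ 1) → (∀ K, 0 ≤ ρ' F θ hP g₀ os K) → (∀ K, ρ' F θ hP g₀ os K ≤ 1) →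
        (∀ K, (0 ≤ epsOfRecord θ.ν (histA₁₃ θ 0 g₀ K) (0 + K) ∧ 0 ≤ epsOfRecord θ.ν (histB₁₃ θ 0 g₀ K) (0 + K + 1)) ∨ ρ F θ hP g₀ os K = 0) →
        (∀ K, (0 ≤ deltaOfRecord θ.ν (histA₁₃ θ 0 g₀ K) (0 + K - 1) θ.A₁ ∧ 0 ≤ deltaOfRecord θ.ν (histB₁₃ θ 0 g₀ K) (0 + K) θ.A₁) ∨ ρ' F θ hP g₀ os K = 0) →
        Summable (fun K => 1 / ((n₁ F θ hP g₀ os K : ℝ) + 1) + 1 / ((n₂ F θ hP g₀ os K : ℝ) + 1)) →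
        ShellWeightBound (crGap2₁₃V N jcut ρ ρ' n₁ n₂ F θ hP g₀ os).l₀ (crGap2₁₃V N jcut ρ ρ' n₁ n₂ F θ hP g₀ os).T (crGap2₁₃V N jcut ρ ρ' n₁ n₂ F θ hP g₀ os).A
          (crGap2₁₃V N jcut ρ ρ' n₁ n₂ F θ hP g₀ os).B (crGap2₁₃V N jcut ρ ρ' n₁ n₂ F θ hP g₀ os).shA (crGap2₁₃V N jcut ρ ρ' n₁ n₂ F θ hP g₀ os).shB
          (crGap2₁₃V N jcut ρ ρ' n₁ n₂ F θ hP g₀ os).Wsh :=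
  fun F θ hP hsel hζm g₀ os hρ0 hρ1 hρ'0 hρ'1 hε hδ hn =>
    shellWeightBound_crGap2₁₃VAt' 0 jcut ρ ρ' n₁ n₂ θ hP g₀ os (E F θ) hsel hζm hρ0 hρ1 hρ'0 hρ'1 hε hδ hn

end AtReading2M

end Summit.QuantumFields.YangMills.Theorems.N21ShellSplitOfRecord13CoPH

end
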